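import Summits.CriticalPhenomena.Ising3D.Control2DAbelianTail
import Summits.CriticalPhenomena.Ising3D.Control2DSpectralDensityAsymptotics
import Mathlib.Analysis.SpecialFunctions.Pow.Real
import Mathlib.Tactic.Linarith
import Mathlib.Tactic.Positivity
import Mathlib.Tactic.FieldSimp
import Mathlib.Tactic.Ring
import HarnessLib

/-!
# The OPE converges exponentially fast with the exact Tauberian prefactor: the states above level `E` weigh
# `≲ ((1 + 2P₀)/Γ(2Δ_σ+1)) E^{2Δ_σ} x^E` — Pappadopulo–Rychkov–Espin–Rattazzi 2012 §4.4 for every unitary typed solution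
(cell `pub-ising3x`, seat controls-1 gen 46; PAPER §6.2 / Appendix E — CONTROL-ONLY; part 2 of 2, part 1 is
`Control2DAbelianTail`; sequel to `Control2DConvergenceRate` (E.1n) and `Control2DSpectralDensityAsymptotics` (E.1u))

HONEST FRAMING: lottery ticket; floor = tightest certified 3D Ising CFT bounds; no exact-solution
claim without a proof. CONTROL-ONLY (`d = 2`, global `sl(2) × sl(2)` blocks, `Δ_σ = s` an INPUT, axiom set
`A2D′`); nothing here is about `d = 3`, no certificate, functional or number of the record is touched, and no
new hypothesis or named fact enters.

WHAT THIS FILE ADDS. `Control2DConvergenceRate` (E.1n) proved the hypothesis-free GEOMETRIC rate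
`Σ'_{Δ_i ≥ E} p_i g_i(x₀,x₀) ≤ e^{2s}(E/(2s))^{2s} G(½,½) · x₀^E` and `Control2DSpectralDensityAsymptotics` (E.1u) the Tauberian
asymptotics `F(E)/E^{2s} → (1 + 2P₀)/Γ(2s+1)` of the integrated weighted spectral density of the diagonal expansion
`G(x,x) - 1 = Σ_{(i,m,m')} W x^{E}` (`W = 2 p_i a_m(h_i) a_{m'}(h̄_i)`, `E = Δ_i + m + m'`, `Control2DDiagonalStates`). PRER 2012
§4.4 turn (4.9) into the SHARP rate (4.18) `ℒ(β,E_*) ≲ E_*^{2Δ_φ} e^{-E_*β}/Γ(2Δ_φ+1)`; composing E.1u with the Abelian tail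
bound of part 1 gives it for the typed class (`β = -log x` on the real diagonal):
* `CrossingData.eventually_tsum_diagWeight_le` — E.1u read as an eventual bound `Σ'_{E_j ≤ u} W_j ≤ (c + δ) u^{2s}`,
  `c = (1 + 2P₀)/Γ(2s+1)`, `P₀ = Σ'_{Δ_i = 0} p_i`;
* **`CrossingData.eventually_statesTail_le (hU) (hC : SatisfiesCrossing s) (hs : 0 < s) (hx : x ∈ (0,1)) (hε : 0 < ε)`** —
  eventually in `E`: `Σ'_{(i,m,m') : E ≤ Δ_i+m+m'} W x^{Δ_i+m+m'} ≤ (c + ε) E^{2s} x^E`: ALL STATES of the diagonal expansion at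
  level `≥ E` (high descendants of low primaries included) weigh `≲ c E^{2Δ_σ} x^E`;
* `CrossingData.tail_le_statesTail` — `Σ'_{E ≤ Δ_i} p_i g_i(x,x) ≤ Σ'_{E ≤ E_j} W_j x^{E_j}` (a state of a primary of
  dimension `≥ E` has level `≥ E`); hence **`eventually_tail_le_sharp`**: eventually
  `G(x,x) - 1 - Σ'_{Δ_i < E} p_i g_i(x,x) = Σ'_{E ≤ Δ_i} p_i g_i(x,x) ≤ (c + ε) E^{2s} x^E` — E.1n's prefactor
  `e^{2s}(E/(2s))^{2s}G(½,½)` sharpened asymptotically to PRER's exact `(1+2P₀)/Γ(2s+1) · E^{2s}`; `_of_pos` /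
  `_of_hasScalarGap` (no weight at dimension `0`: constant `1/Γ(2s+1)`, PRER's normalisation exactly); `_offDiag` (every point
  of the square dominated by `(x,x)`, by `globalBlock_mono`, as E.1n);
* hypothesis-free and non-asymptotic (PRER (4.10)–(4.11) for the STATES count): `tsum_diagWeight_le_two_point`
  (`Σ'_{E_j ≤ E} W_j ≤ x^{-E}(G(x,x) - 1)`), **`spectralCount_le`** (`F(E) ≤ 1 + e^{2s}(E/(2s))^{2s} G(½,½)` for `E ≥ 2s`, at
  E.1n's rate point `x = E/(E+2s)`), **`statesTail_le`** (for `E ≥ 2s`, `E(-log x) > 2s`: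
  `Σ'_{E ≤ E_j} W_j x^{E_j} ≤ e^{2s} G(½,½) (E/(2s))^{2s} x^E · E(-log x)/(E(-log x) - 2s)` — every state above `E`, the
  crossing-symmetric value `G(½,½)` the only datum-dependent constant);
* `record_tail_le_sharp (w)` — at `Δ_σ = 1/8` on the record's class (`P₀ = 0` proved via `twoSided_2d_kernel099`):
  eventually `Σ'_{E ≤ Δ_i} p_i g_i(x,x) ≤ (1/Γ(5/4) + ε) E^{1/4} x^E`.
Attribution and honest delta: the statement is PRER 2012 §4.4 (4.17)→(4.18); ours is its elementary discrete-Abel version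
for the typed class composed with E.1u — recorded because it makes E.1n's constant sharp; CONTROL-ONLY (`d = 2`, global
blocks, `s` an input), nothing about any CFT beyond the typed sum rule, nothing about `d = 3`.

NOT claimed: any LOWER bound on a tail (none holds pointwise in `E`); PRER's logarithmic error term (4.12)–(4.13); the
`ρ`-coordinate rate (their §4.3 / (4.19)ff.); anything off the real square beyond monotone domination; a bound on any single
`p_i` beyond E.1n; anything at `s = 0`; Virasoro; anything three-dimensional; no number of the record touched.

References: D. Pappadopulo, S. Rychkov, J. Espin, R. Rattazzi, Phys. Rev. D 86 (2012) 105043, §4.2 (4.10)–(4.11), §4.4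
(4.16)–(4.18) [cite: PappadopuloRychkovEspinRattazzi2012PRD, §4.4]; R. Rattazzi, V. S. Rychkov, E. Tonni, A. Vichi,
JHEP 12 (2008) 031, §3 [cite: RattazziEtAl2008, §3]. Tree: `tsum_ge_mul_exp_le_of_le_rpow`, `eventually_tsum_ge_mul_exp_le`
(`Control2DAbelianTail`); `tendsto_spectralCount_div_rpow`, `tsum_p_dim_zero_eq_zero` (`Control2DSpectralDensityAsymptotics`);
`diagWeight`, `diagLevel`, `spectralCount`, `hasSum_diagStates`, `hasSum_diagStates_fiber`, `hasSum_laplace`,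
`summable_diagWeight_le` (`Control2DDiagonalStates`); `ratePoint_spec`, `fourPoint_diag_le` (`Control2DConvergenceRate`);
`opeConvergent_free` (`Control2DOpeConvergenceFree`); `globalBlock_mono`, `one_le_fourPoint` (`Control2DFourPoint`);
`two_le_of_spin_ne_zero`, `lowerBound_of_location`, `twoSided_2d_kernel099` (the record). Mathlib: `Summable.tsum_prod`,
`tsum_subtype`, `Set.indicator_le_indicator_of_subset`, `Summable.tsum_le_tsum`, `Summable.tsum_subtype_le`,
`Real.rpow_def_of_pos`, `Real.rpow_le_rpow_of_exponent_ge`, `Metric.tendsto_nhds`.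
-/

namespace Summit.CriticalPhenomena.Ising3D.Control2D

open Set Filter Topology
open Literature.MathematicalPhysics.QuantumFieldTheory.ConformalBootstrap3D

/-! ### The typed class: the states of the diagonal expansion above a level -/

namespace CrossingData

variable {D : CrossingData} {s : ℝ}

/-- From E.1u: for every `δ > 0`, eventually `Σ'_{E_j ≤ u} W_j = F(u) - 1 ≤ ((1+2P₀)/Γ(2s+1) + δ) u^{2s}`.
[cite: PappadopuloRychkovEspinRattazzi2012PRD, §4.2 eq. (4.9)] -/
theorem eventually_tsum_diagWeight_le (hU : D.IsUnitary) (hC : D.SatisfiesCrossing s) (hs : 0 < s)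
    {δ : ℝ} (hδ : 0 < δ) :
    ∀ᶠ u : ℝ in atTop, ∑' j : ↥({j : D.ι × ℕ × ℕ | D.diagLevel j ≤ u} : Set (D.ι × ℕ × ℕ)), D.diagWeight j ≤
      ((1 + 2 * ∑' i : ↥({i : D.ι | D.Δ i = 0} : Set D.ι), D.p i) / Real.Gamma (2 * s + 1) + δ) *
        u ^ (2 * s) := by
  set c : ℝ := (1 + 2 * ∑' i : ↥({i : D.ι | D.Δ i = 0} : Set D.ι), D.p i) / Real.Gamma (2 * s + 1) with hc
  have h := tendsto_spectralCount_div_rpow hU hC hs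
  have hev := (Metric.tendsto_nhds.mp h) δ hδ
  filter_upwards [hev, eventually_gt_atTop 0] with u hu hu0
  have hX : 0 < u ^ (2 * s) := Real.rpow_pos_of_pos hu0 _
  rw [Real.dist_eq, abs_lt] at hu
  have h2 : D.spectralCount u < (c + δ) * u ^ (2 * s) := by
    have h3 : D.spectralCount u / u ^ (2 * s) < c + δ := by linarith [hu.2]
    exact (div_lt_iff₀ hX).mp h3
  have h4 : ∑' j : ↥({j : D.ι × ℕ × ℕ | D.diagLevel j ≤ u} : Set (D.ι × ℕ × ℕ)), D.diagWeight j =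
      D.spectralCount u - 1 := by rw [spectralCount]; ring
  rw [h4]
  linarith

/-- **The sharp convergence rate for the states** (Pappadopulo–Rychkov–Espin–Rattazzi 2012 §4.4 for the typed class).
For every unitary solution of the typed `⟨σσσσ⟩` sum rule at `Δ_σ = s > 0`, every diagonal point `x ∈ (0,1)` and every
`ε > 0`, eventually in the cut-off `E`:
`Σ'_{(i,m,m') : E ≤ Δ_i+m+m'} 2 p_i a_m(h_i) a_{m'}(h̄_i) x^{Δ_i+m+m'} ≤ ((1 + 2P₀)/Γ(2s+1) + ε) · E^{2s} · x^E`
(`P₀ = Σ'_{Δ_i = 0} p_i`) — the total weight that ALL STATES of the diagonal expansion at level `≥ E` (high descendants of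
low primaries included) contribute to `G(x,x)` decays like `E^{2Δ_σ} x^E` with the exact Tauberian prefactor: the Abelian
tail bound applied to E.1u's `F(E)/E^{2s} → (1+2P₀)/Γ(2s+1)`, `x = e^{-t}`. Only an upper bound (no lower bound holds
pointwise in `E`: the levels may leave gaps of length `o(E)`). [cite: PappadopuloRychkovEspinRattazzi2012PRD, §4.4] -/
theorem eventually_statesTail_le (hU : D.IsUnitary) (hC : D.SatisfiesCrossing s) (hs : 0 < s) {x : ℝ}
    (hx : x ∈ Ioo (0 : ℝ) 1) {ε : ℝ} (hε : 0 < ε) :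
    ∀ᶠ E : ℝ in atTop,
      ∑' j : ↥({j : D.ι × ℕ × ℕ | E ≤ D.diagLevel j} : Set (D.ι × ℕ × ℕ)), D.diagWeight j * x ^ D.diagLevel j ≤
        ((1 + 2 * ∑' i : ↥({i : D.ι | D.Δ i = 0} : Set D.ι), D.p i) / Real.Gamma (2 * s + 1) + ε) *
          E ^ (2 * s) * x ^ E := by
  have ht : 0 < -Real.log x := neg_pos.mpr (Real.log_neg hx.1 hx.2)
  have hxt : ∀ y : ℝ, x ^ y = Real.exp (-(-Real.log x * y)) := fun y => by
    rw [Real.rpow_def_of_pos hx.1, neg_mul, neg_neg]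
  have hconv := opeConvergent_free hU hC hs
  have key := eventually_tsum_ge_mul_exp_le (w := D.diagWeight) (E := D.diagLevel) (diagWeight_nonneg hU)
    (fun t ht' => (hasSum_laplace hU hconv ht').summable) (by linarith : (0 : ℝ) ≤ 2 * s) ht
    (fun δ hδ => eventually_tsum_diagWeight_le hU hC hs hδ) hε
  simp only [hxt]
  exact key

/-- **The primaries above `E` weigh less than the states above `E`**: for unitary OPE-convergent data, `x ∈ (0,1)`,
`Σ'_{i : E ≤ Δ_i} p_i g_i(x,x) ≤ Σ'_{j : E ≤ E_j} W_j x^{E_j}` — every state `(i,m,m')` of a quasi-primary of dimension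
`≥ E` has level `Δ_i + m + m' ≥ E` (fibrewise sums `hasSum_diagStates_fiber`; Mathlib `Summable.tsum_prod`, indicators).
[folklore] -/
theorem tail_le_statesTail (hU : D.IsUnitary) (hconv : D.OpeConvergent) {x : ℝ} (hx : x ∈ Ioo (0 : ℝ) 1)
    (E : ℝ) :
    ∑' i : ↥({i : D.ι | E ≤ D.Δ i} : Set D.ι), D.p i * globalBlock (D.Δ i) (D.spin i) x x ≤
      ∑' j : ↥({j : D.ι × ℕ × ℕ | E ≤ D.diagLevel j} : Set (D.ι × ℕ × ℕ)), D.diagWeight j * x ^ D.diagLevel j := by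
  set f : D.ι × ℕ × ℕ → ℝ := fun j => D.diagWeight j * x ^ D.diagLevel j with hf
  have hf0 : ∀ j, 0 ≤ f j := fun j => mul_nonneg (diagWeight_nonneg hU j) (Real.rpow_nonneg hx.1.le _)
  have hS : Summable f := (hasSum_diagStates hU hconv hx).summable
  set A : Set (D.ι × ℕ × ℕ) := {j | E ≤ D.Δ j.1} with hA
  set B : Set (D.ι × ℕ × ℕ) := {j | E ≤ D.diagLevel j} with hB
  have hAB : A ⊆ B := fun j hj => by
    have h1 : E ≤ D.Δ j.1 := hj
    have h2 : (0 : ℝ) ≤ j.2.1 := Nat.cast_nonneg _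
    have h3 : (0 : ℝ) ≤ j.2.2 := Nat.cast_nonneg _
    show E ≤ D.diagLevel j
    unfold diagLevel
    linarith
  have hfib : ∀ i : D.ι, ∑' mm : ℕ × ℕ, A.indicator f (i, mm) =
      ({i : D.ι | E ≤ D.Δ i} : Set D.ι).indicator (fun i => D.p i * globalBlock (D.Δ i) (D.spin i) x x) i := by
    intro i
    by_cases hi : E ≤ D.Δ i
    · have hmem : ∀ mm : ℕ × ℕ, ((i, mm) : D.ι × ℕ × ℕ) ∈ A := fun mm => hi
      rw [indicator_of_mem (show i ∈ ({i : D.ι | E ≤ D.Δ i} : Set D.ι) from hi),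
        ← (hasSum_diagStates_fiber hU i hx).tsum_eq]
      exact tsum_congr fun mm => indicator_of_mem (hmem mm) f
    · have hnot : ∀ mm : ℕ × ℕ, ((i, mm) : D.ι × ℕ × ℕ) ∉ A := fun mm h => hi h
      rw [indicator_of_notMem (show i ∉ ({i : D.ι | E ≤ D.Δ i} : Set D.ι) from hi),
        tsum_congr (fun mm => indicator_of_notMem (hnot mm) f), tsum_zero]
  have h1 : ∑' i : ↥({i : D.ι | E ≤ D.Δ i} : Set D.ι), D.p i * globalBlock (D.Δ i) (D.spin i) x x =
      ∑' j, A.indicator f j := by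
    rw [tsum_subtype ({i : D.ι | E ≤ D.Δ i} : Set D.ι) (fun i => D.p i * globalBlock (D.Δ i) (D.spin i) x x),
      (hS.indicator A).tsum_prod]
    exact (tsum_congr hfib).symm
  rw [h1, tsum_subtype B f]
  exact (hS.indicator A).tsum_le_tsum (fun j => indicator_le_indicator_of_subset hAB hf0 j) (hS.indicator B)

/-- **The sharp convergence rate of the conformal block expansion on the diagonal** (PRER 2012 §4.4, their
«`ℒ(β,E_*) ≲ E_*^{2Δ_φ} e^{-E_*β}/Γ(2Δ_φ+1)` … the OPE expansion for the four point function converges exponentially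
fast», for the typed class, `β = -log x`). For every unitary solution of the typed sum rule at `Δ_σ = s > 0`, every
`x ∈ (0,1)` and `ε > 0`, eventually in `E`:
`G(x,x) - 1 - Σ'_{Δ_i < E} p_i g_i(x,x) = Σ'_{i : E ≤ Δ_i} p_i g_i(x,x) ≤ ((1 + 2P₀)/Γ(2s+1) + ε) · E^{2s} · x^E` —
the prefactor `e^{2s}(E/(2s))^{2s} G(½,½)` of the hypothesis-free `Control2DConvergenceRate.tail_le` (E.1n) sharpened
asymptotically to the exact `(1+2P₀)/Γ(2s+1)`. [cite: PappadopuloRychkovEspinRattazzi2012PRD, §4.4] -/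
theorem eventually_tail_le_sharp (hU : D.IsUnitary) (hC : D.SatisfiesCrossing s) (hs : 0 < s) {x : ℝ}
    (hx : x ∈ Ioo (0 : ℝ) 1) {ε : ℝ} (hε : 0 < ε) :
    ∀ᶠ E : ℝ in atTop,
      ∑' i : ↥({i : D.ι | E ≤ D.Δ i} : Set D.ι), D.p i * globalBlock (D.Δ i) (D.spin i) x x ≤
        ((1 + 2 * ∑' i : ↥({i : D.ι | D.Δ i = 0} : Set D.ι), D.p i) / Real.Gamma (2 * s + 1) + ε) *
          E ^ (2 * s) * x ^ E :=
  (eventually_statesTail_le hU hC hs hx hε).mono fun E hE =>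
    (tail_le_statesTail hU (opeConvergent_free hU hC hs) hx E).trans hE

/-- **No weight at dimension zero: the rate with PRER's normalisation exactly**, `Σ'_{E ≤ Δ_i} p_i g_i(x,x) ≤
(1/Γ(2s+1) + ε) E^{2s} x^E` eventually, for every unitary solution at `s > 0` all of whose weighted labels have positive
dimension. [cite: PappadopuloRychkovEspinRattazzi2012PRD, §4.4] -/
theorem eventually_tail_le_sharp_of_pos (hU : D.IsUnitary) (hC : D.SatisfiesCrossing s) (hs : 0 < s)
    (hpos : ∀ i, D.p i ≠ 0 → 0 < D.Δ i) {x : ℝ} (hx : x ∈ Ioo (0 : ℝ) 1) {ε : ℝ} (hε : 0 < ε) :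
    ∀ᶠ E : ℝ in atTop,
      ∑' i : ↥({i : D.ι | E ≤ D.Δ i} : Set D.ι), D.p i * globalBlock (D.Δ i) (D.spin i) x x ≤
        (1 / Real.Gamma (2 * s + 1) + ε) * E ^ (2 * s) * x ^ E := by
  have h := eventually_tail_le_sharp hU hC hs hx hε
  rw [tsum_p_dim_zero_eq_zero hpos, mul_zero, add_zero] at h
  exact h

/-- **Under a scalar gap `U > 0`** (scalars `Δ ≥ U > 0`, spinning labels `Δ ≥ ℓ ≥ 2`): eventually
`Σ'_{E ≤ Δ_i} p_i g_i(x,x) ≤ (1/Γ(2s+1) + ε) E^{2s} x^E`. [cite: PappadopuloRychkovEspinRattazzi2012PRD, §4.4] -/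
theorem eventually_tail_le_sharp_of_hasScalarGap (hU : D.IsUnitary) (hC : D.SatisfiesCrossing s) (hs : 0 < s)
    {U : ℝ} (hgap : D.HasScalarGap U) (hU0 : 0 < U) {x : ℝ} (hx : x ∈ Ioo (0 : ℝ) 1) {ε : ℝ} (hε : 0 < ε) :
    ∀ᶠ E : ℝ in atTop,
      ∑' i : ↥({i : D.ι | E ≤ D.Δ i} : Set D.ι), D.p i * globalBlock (D.Δ i) (D.spin i) x x ≤
        (1 / Real.Gamma (2 * s + 1) + ε) * E ^ (2 * s) * x ^ E := by
  refine eventually_tail_le_sharp_of_pos hU hC hs (fun i _ => ?_) hx hε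
  by_cases h0 : D.spin i = 0
  · exact lt_of_lt_of_le hU0 (hgap i h0)
  · exact lt_of_lt_of_le (by norm_num) (two_le_of_spin_ne_zero hU h0)

/-- **Off the diagonal**: for `0 < z, z̄ ≤ x < 1` the tail at `(z,z̄)` is at most the tail at `(x,x)` (`globalBlock_mono`,
as in E.1n `tail_le_offDiag`), so eventually `Σ'_{E ≤ Δ_i} p_i g_i(z,z̄) ≤ ((1+2P₀)/Γ(2s+1) + ε) E^{2s} x^E` at every point of
the square dominated by `(x,x)`. [cite: PappadopuloRychkovEspinRattazzi2012PRD, §4.4] -/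
theorem eventually_tail_le_sharp_offDiag (hU : D.IsUnitary) (hC : D.SatisfiesCrossing s) (hs : 0 < s)
    {z zb x : ℝ} (hz : 0 < z) (hzb : 0 < zb) (hzx : z ≤ x) (hzbx : zb ≤ x) (hx1 : x < 1) {ε : ℝ} (hε : 0 < ε) :
    ∀ᶠ E : ℝ in atTop,
      ∑' i : ↥({i : D.ι | E ≤ D.Δ i} : Set D.ι), D.p i * globalBlock (D.Δ i) (D.spin i) z zb ≤
        ((1 + 2 * ∑' i : ↥({i : D.ι | D.Δ i = 0} : Set D.ι), D.p i) / Real.Gamma (2 * s + 1) + ε) *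
          E ^ (2 * s) * x ^ E := by
  have hconv := opeConvergent_free hU hC hs
  have hx : x ∈ Ioo (0 : ℝ) 1 := ⟨lt_of_lt_of_le hz hzx, hx1⟩
  have hzI : z ∈ Ioo (0 : ℝ) 1 := ⟨hz, lt_of_le_of_lt hzx hx1⟩
  have hzbI : zb ∈ Ioo (0 : ℝ) 1 := ⟨hzb, lt_of_le_of_lt hzbx hx1⟩
  refine (eventually_tail_le_sharp hU hC hs hx hε).mono fun E hE => le_trans ?_ hE
  exact ((hconv z zb hzI hzbI).subtype _).tsum_le_tsum
    (fun i => mul_le_mul_of_nonneg_left (globalBlock_mono (hU i).2.1 hz hzb hzx hzbx hx1 hx1) (hU i).2.2)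
    ((hconv x x hx hx).subtype _)

/-! ### Hypothesis-free and non-asymptotic: the states count and an explicit tail -/

/-- **Two-point bound for the states below `E`**: `Σ'_{E_j ≤ E} W_j ≤ x^{-E} (G(x,x) - 1)` for `x ∈ (0,1)` — PRER's
«obvious estimate» `ℒ(β) ≥ e^{-βE} F(E)` for the typed class (`x^{E_j} ≥ x^E` below `E`, `Σ_j W_j x^{E_j} = G(x,x) - 1`).
[cite: PappadopuloRychkovEspinRattazzi2012PRD, §4.2] -/
theorem tsum_diagWeight_le_two_point (hU : D.IsUnitary) (hconv : D.OpeConvergent) {x : ℝ}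
    (hx : x ∈ Ioo (0 : ℝ) 1) (E : ℝ) :
    ∑' j : ↥({j : D.ι × ℕ × ℕ | D.diagLevel j ≤ E} : Set (D.ι × ℕ × ℕ)), D.diagWeight j ≤
      (x ^ E)⁻¹ * (D.fourPoint x x - 1) := by
  have H := hasSum_diagStates hU hconv hx
  set S : Set (D.ι × ℕ × ℕ) := {j | D.diagLevel j ≤ E} with hSdef
  have hxE : 0 < x ^ E := Real.rpow_pos_of_pos hx.1 E
  have hpt : ∀ j : ↥S, D.diagWeight j ≤ (x ^ E)⁻¹ * (D.diagWeight j * x ^ D.diagLevel j) := fun j => by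
    have hj : D.diagLevel (j : D.ι × ℕ × ℕ) ≤ E := j.2
    have hpow : x ^ E ≤ x ^ D.diagLevel (j : D.ι × ℕ × ℕ) := Real.rpow_le_rpow_of_exponent_ge hx.1 hx.2.le hj
    have hW := diagWeight_nonneg hU (j : D.ι × ℕ × ℕ)
    calc D.diagWeight j = (x ^ E)⁻¹ * (D.diagWeight j * x ^ E) := by field_simp
      _ ≤ (x ^ E)⁻¹ * (D.diagWeight j * x ^ D.diagLevel (j : D.ι × ℕ × ℕ)) :=
          mul_le_mul_of_nonneg_left (mul_le_mul_of_nonneg_left hpow hW) (inv_nonneg.mpr hxE.le)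
  have hS1 : Summable fun j : ↥S => D.diagWeight j := summable_diagWeight_le hU hconv E
  have hS2 : Summable fun j : ↥S => (x ^ E)⁻¹ * (D.diagWeight j * x ^ D.diagLevel j) :=
    (H.summable.subtype S).mul_left _
  have hsub : ∑' j : ↥S, D.diagWeight j * x ^ D.diagLevel j ≤ ∑' j, D.diagWeight j * x ^ D.diagLevel j :=
    H.summable.tsum_subtype_le _ S fun j => mul_nonneg (diagWeight_nonneg hU j) (Real.rpow_nonneg hx.1.le _)
  calc ∑' j : ↥S, D.diagWeight j ≤ ∑' j : ↥S, (x ^ E)⁻¹ * (D.diagWeight j * x ^ D.diagLevel j) :=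
        hS1.tsum_le_tsum hpt hS2
    _ = (x ^ E)⁻¹ * ∑' j : ↥S, D.diagWeight j * x ^ D.diagLevel j := tsum_mul_left
    _ ≤ (x ^ E)⁻¹ * ∑' j, D.diagWeight j * x ^ D.diagLevel j :=
        mul_le_mul_of_nonneg_left hsub (inv_nonneg.mpr hxE.le)
    _ = (x ^ E)⁻¹ * (D.fourPoint x x - 1) := by rw [H.tsum_eq]

/-- **The states count is polynomially bounded, hypothesis-free** (PRER (4.10)–(4.11), «`F(E) ≤ e^b ℒ(b/E) ≤ const ·
e^b b^{-2Δ_φ} E^{2Δ_φ}`, `b = 2Δ_φ`», for the typed class with every constant explicit): for every unitary solution of the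
typed sum rule at `Δ_σ = s > 0` and every `E ≥ 2s`, `F(E) ≤ 1 + e^{2s} (E/(2s))^{2s} G(½,½)` (the two-point bound at
E.1n's rate point `x = E/(E+2s)` and E.1n's growth bound `G(x,x) ≤ (x/(1-x))^{2s} G(½,½)`).
[cite: PappadopuloRychkovEspinRattazzi2012PRD, §4.2] -/
theorem spectralCount_le (hU : D.IsUnitary) (hC : D.SatisfiesCrossing s) (hs : 0 < s) {E : ℝ} (hE : 2 * s ≤ E) :
    D.spectralCount E ≤ 1 + Real.exp (2 * s) * (E / (2 * s)) ^ (2 * s) * D.fourPoint (1 / 2) (1 / 2) := by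
  have hconv := opeConvergent_free hU hC hs
  obtain ⟨hx0, hx1, hx2, hratio, hinv⟩ := ratePoint_spec hs hE
  have h1 := tsum_diagWeight_le_two_point hU hconv ⟨hx0, hx1⟩ E
  have h2 := fourPoint_diag_le hU hC hs hx2 hx1
  rw [hratio] at h2
  have hG1 : 1 ≤ D.fourPoint (1 / 2) (1 / 2) :=
    one_le_fourPoint hU (z := 1 / 2) (zb := 1 / 2) ⟨by norm_num, by norm_num⟩ ⟨by norm_num, by norm_num⟩
  have hP : 0 ≤ (E / (2 * s)) ^ (2 * s) * D.fourPoint (1 / 2) (1 / 2) :=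
    mul_nonneg (Real.rpow_nonneg (div_pos (by linarith) (by linarith)).le _) (by linarith)
  have hinv0 : 0 ≤ ((E / (E + 2 * s)) ^ E)⁻¹ := inv_nonneg.mpr (Real.rpow_pos_of_pos hx0 E).le
  unfold spectralCount
  have h3 : ((E / (E + 2 * s)) ^ E)⁻¹ * (D.fourPoint (E / (E + 2 * s)) (E / (E + 2 * s)) - 1) ≤
      ((E / (E + 2 * s)) ^ E)⁻¹ * ((E / (2 * s)) ^ (2 * s) * D.fourPoint (1 / 2) (1 / 2)) :=
    mul_le_mul_of_nonneg_left (by linarith) hinv0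
  have h4 : ((E / (E + 2 * s)) ^ E)⁻¹ * ((E / (2 * s)) ^ (2 * s) * D.fourPoint (1 / 2) (1 / 2)) ≤
      Real.exp (2 * s) * ((E / (2 * s)) ^ (2 * s) * D.fourPoint (1 / 2) (1 / 2)) :=
    mul_le_mul_of_nonneg_right hinv hP
  linarith

/-- **An explicit states tail, hypothesis-free** (the Abelian tail bound on the polynomial bound `spectralCount_le`):
for every unitary solution of the typed sum rule at `Δ_σ = s > 0`, every `x ∈ (0,1)` and every cut-off `E ≥ 2s` with
`E·(-log x) > 2s`,
`Σ'_{j : E ≤ E_j} W_j x^{E_j} ≤ e^{2s} G(½,½) (E/(2s))^{2s} x^E · E(-log x)/(E(-log x) - 2s)` — every state above `E`,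
no asymptotics, the crossing-symmetric value `G(½,½)` the only datum-dependent constant.
[cite: PappadopuloRychkovEspinRattazzi2012PRD, §4.4] -/
theorem statesTail_le (hU : D.IsUnitary) (hC : D.SatisfiesCrossing s) (hs : 0 < s) {x E : ℝ}
    (hx : x ∈ Ioo (0 : ℝ) 1) (hE : 2 * s ≤ E) (hEx : 2 * s < -Real.log x * E) :
    ∑' j : ↥({j : D.ι × ℕ × ℕ | E ≤ D.diagLevel j} : Set (D.ι × ℕ × ℕ)), D.diagWeight j * x ^ D.diagLevel j ≤
      Real.exp (2 * s) * D.fourPoint (1 / 2) (1 / 2) * (E / (2 * s)) ^ (2 * s) * x ^ E *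
        (-Real.log x * E / (-Real.log x * E - 2 * s)) := by
  have ht : 0 < -Real.log x := neg_pos.mpr (Real.log_neg hx.1 hx.2)
  have hxt : ∀ y : ℝ, x ^ y = Real.exp (-(-Real.log x * y)) := fun y => by
    rw [Real.rpow_def_of_pos hx.1, neg_mul, neg_neg]
  have hconv := opeConvergent_free hU hC hs
  have hE0 : 0 < E := by linarith
  set B : ℝ := Real.exp (2 * s) * D.fourPoint (1 / 2) (1 / 2) / (2 * s) ^ (2 * s) with hBdef
  have hB : ∀ u : ℝ, E ≤ u →
      ∑' j : ↥({j : D.ι × ℕ × ℕ | D.diagLevel j ≤ u} : Set (D.ι × ℕ × ℕ)), D.diagWeight j ≤ B * u ^ (2 * s) := by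
    intro u hu
    have h1 := spectralCount_le hU hC hs (hE.trans hu)
    have h2 : ∑' j : ↥({j : D.ι × ℕ × ℕ | D.diagLevel j ≤ u} : Set (D.ι × ℕ × ℕ)), D.diagWeight j =
        D.spectralCount u - 1 := by rw [spectralCount]; ring
    rw [h2, hBdef, Real.div_rpow (by linarith) (by linarith)] at *
    have : Real.exp (2 * s) * (u ^ (2 * s) / (2 * s) ^ (2 * s)) * D.fourPoint (1 / 2) (1 / 2) =
        Real.exp (2 * s) * D.fourPoint (1 / 2) (1 / 2) / (2 * s) ^ (2 * s) * u ^ (2 * s) := by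
      field_simp
    linarith
  have key := tsum_ge_mul_exp_le_of_le_rpow (w := D.diagWeight) (E := D.diagLevel) (diagWeight_nonneg hU)
    (fun t ht' => (hasSum_laplace hU hconv ht').summable) (by linarith : (0 : ℝ) ≤ 2 * s) hE0 ht hEx hB
  simp only [hxt]
  refine key.trans (le_of_eq ?_)
  rw [hBdef, Real.div_rpow hE0.le (by linarith)]
  field_simp

end CrossingData

/-! ### The record's class at `Δ_σ = 1/8` -/

/-- **At `Δ_σ = 1/8`, for every datum of the record's class** (unitary, typed sum rule, spin 2 in `{2} ∪ [3,∞)`,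
scalars in `{x₀} ∪ [2,∞)` with `w ≤ x₀`, hence all labels `≥ 99/100` by `twoSided_2d_kernel099`, so `P₀ = 0` is proved):
for every `x ∈ (0,1)` and `ε > 0`, eventually in `E` the tail of the conformal block expansion on the diagonal obeys
`Σ'_{E ≤ Δ_i} p_i g_i(x,x) ≤ (1/Γ(5/4) + ε) E^{1/4} x^E`. CONTROL-ONLY; no certificate or number of the record is
touched. [folklore] -/
theorem record_tail_le_sharp (w : ℝ) (D : CrossingData) (hU : D.IsUnitary) (hC : D.SatisfiesCrossing (1 / 8))
    (hT : D.SpinTwoIn ({2} ∪ Ici (2 + 1))) (x₀ : ℝ) (hwx : w ≤ x₀) (hS : D.ScalarsIn ({x₀} ∪ Ici 2))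
    {x : ℝ} (hx : x ∈ Ioo (0 : ℝ) 1) {ε : ℝ} (hε : 0 < ε) :
    ∀ᶠ E : ℝ in atTop,
      ∑' i : ↥({i : D.ι | E ≤ D.Δ i} : Set D.ι), D.p i * globalBlock (D.Δ i) (D.spin i) x x ≤
        (1 / Real.Gamma (5 / 4) + ε) * E ^ (1 / 4 : ℝ) * x ^ E := by
  have hx₀ : (99 / 100 : ℝ) < x₀ := ((twoSided_2d_kernel099 w) D hU hC hT x₀ hwx hS).1
  have hτ : ∀ i, (99 / 100 : ℝ) ≤ D.Δ i := fun i =>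
    le_trans (le_min (le_min hx₀.le (by norm_num)) (by norm_num)) (CrossingData.lowerBound_of_location hU hS i)
  have hpos : ∀ i, D.p i ≠ 0 → 0 < D.Δ i := fun i _ => lt_of_lt_of_le (by norm_num) (hτ i)
  have h := CrossingData.eventually_tail_le_sharp_of_pos hU hC (by norm_num) hpos hx hε
  have e1 : (2 : ℝ) * (1 / 8) = 1 / 4 := by norm_num
  have e2 : (2 : ℝ) * (1 / 8) + 1 = 5 / 4 := by norm_num
  rw [e2] at h
  simp only [e1] at h
  exact h


end Summit.CriticalPhenomena.Ising3D.Control2D
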